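import Mathlib
import Summits.Ventures.PercRepro2.Defs
import Summits.Ventures.PercRepro2.Independence
import Summits.Ventures.PercRepro2.Harris
import Summits.Ventures.PercRepro2.Graph
import Summits.Ventures.PercRepro2.Exploration
import Summits.Ventures.PercRepro2.Events
import Summits.Ventures.PercRepro2.FourFunctions
import Summits.Ventures.PercRepro2.Induced
import Summits.Ventures.PercRepro2.Frontier
import Summits.Ventures.PercRepro2.ObsIndependence
import Summits.Ventures.PercRepro2.BHK
import Summits.Ventures.PercRepro2.BHKEvents
import Summits.Ventures.PercRepro2.SideAgreement
import Summits.Ventures.PercRepro2.VdBKahn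
import Summits.Ventures.PercRepro2.BHKAvoid
import Summits.Ventures.PercRepro2.R2PrimeThreeReduction
import Summits.Ventures.PercRepro2.YBridge
import Summits.Ventures.PercRepro2.Yu1Functionals
import Summits.Ventures.PercRepro2.Yu1Events
import Summits.Ventures.PercRepro2.Yu1
import Summits.Ventures.PercRepro2.LBSplit
import Summits.Ventures.PercRepro2.YDelta
import Summits.Ventures.PercRepro2.SD
import Summits.Ventures.PercRepro2.Threshold
import Summits.Ventures.PercRepro2.Lambda
import Summits.Ventures.PercRepro2.LambdaTau
import Summits.Ventures.PercRepro2.LambdaSlack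
import Summits.Ventures.PercRepro2.HF2
import Summits.Ventures.PercRepro2.Yu2
import Summits.Ventures.PercRepro2.N0
import Summits.Ventures.PercRepro2.Y
import Summits.Ventures.PercRepro2.YDeltaTools
import Summits.Ventures.PercRepro2.ZDelta
import Summits.Ventures.PercRepro2.ZExpand
import Summits.Ventures.PercRepro2.ISplit
import Summits.Ventures.PercRepro2.MRl
import Summits.Ventures.PercRepro2.ZOloc
import Summits.Ventures.PercRepro2.SideBridge
import Summits.Ventures.PercRepro2.HCov
import Summits.Ventures.PercRepro2.ChordBase

/-!
# Row 2′EDM/D: edge-deletion monotonicity of `G/D`, and its reduction to (HCOV) (blind cell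
PercRepro2, typer-1; lead g11 CONJECTURES v2.99e 10:24:15Z — the only surviving one-edge reduction
of (HCOV): mine-c j191020 0 / 4,108,320 + engine D51 j191237 0 / 4,108,320 at `n = 6` FULL
adversarial, mine-a climbs 0 exact negatives at `n = 6, 7`; the un-normalised row 2′EDM is FALSE,
NEG-52)

With `G = Gc / (D · P(Q))` and `G/D = Gc / (D² · P(Q))`, and `p[e ↦ 0]` the instance with `e` deleted:

* **`EdmD`** (cleared): `(1 − p_e) · Gc(p[e↦0]) · D(p)² · P_p(Q) ≤ Gc(p) · D(p[e↦0])² · P_{p[e↦0]}(Q)`,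
  i.e. `(G/D)(p) ≥ (1 − p_e) · (G/D)(p[e↦0])` when the denominators are positive; `EdmD_all`;
* `prob_le_prob_update_zero_of_isLowerSet`: deleting an edge can only increase a decreasing event
  (`PD` and `Q` are decreasing: `isLowerSet_PDEvent`, `isLowerSet_avoidAll`), so the denominators
  never vanish along the way;
* **`HCov_of_edmD`** / **`HCov_all_of_edmD_all`**: 2′EDM/D ⟹ (HCOV) by induction on the number of
  edges of positive weight — the base (`p ≡ 0`: no fractional root edge) is
  `Chord.Gc_eq_zero_of_rootEdges_empty`, the step is the row at one positive edge.
-/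

namespace Summit.Ventures.PercRepro2

open UnionCluster CovForm

namespace EdmRow

variable {V : Type*} {E : Type*} [Fintype E] [DecidableEq E] {R : Type*} [Field R]
  [LinearOrder R] [IsStrictOrderedRing R]

section Defs

variable (p : E → R) (ends : E → Sym2 V)

/-- **Row 2′EDM/D** at the edge `e` (cleared):
`(1 − p_e) · Gc(p[e↦0]) · D(p)² · P_p(Q) ≤ Gc(p) · D(p[e↦0])² · P_{p[e↦0]}(Q)`. -/
def EdmD (e : E) (o a₁ a₂ a₃ b : V) : Prop :=
  (1 - p e) * Gc (Function.update p e 0) ends o a₁ a₂ a₃ b *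
      prob p (PDEvent ends a₁ a₂ a₃) ^ 2 * prob p (avoidAll ends a₂ {a₁}) ≤
    Gc p ends o a₁ a₂ a₃ b * prob (Function.update p e 0) (PDEvent ends a₁ a₂ a₃) ^ 2 *
      prob (Function.update p e 0) (avoidAll ends a₂ {a₁})

end Defs

section Closure

variable (R : Type*) [Field R] [LinearOrder R] [IsStrictOrderedRing R]

/-- Row 2′EDM/D over all finite graphs, admissible weights, edges and markings. -/
def EdmD_all : Prop :=
  ∀ (V E : Type) [Fintype V] [DecidableEq V] [Fintype E] [DecidableEq E]
    (ends : E → Sym2 V) (p : E → R), IsProbVec p →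
    ∀ (e : E) (o a₁ a₂ a₃ b : V), a₁ ≠ a₂ → a₁ ≠ a₃ → a₂ ≠ a₃ → o ≠ a₁ → o ≠ a₂ → o ≠ a₃ →
      o ≠ b → b ≠ a₁ → b ≠ a₂ → b ≠ a₃ → EdmD p ends e o a₁ a₂ a₃ b

end Closure

/-! ## Decreasing events grow under edge deletion -/

section Monotone

variable {p : E → R} (ends : E → Sym2 V)

/-- Deleting an edge can only increase the probability of a decreasing event. -/
lemma prob_le_prob_update_zero_of_isLowerSet (hp : IsProbVec p) {A : Set (Config E)}
    (hA : IsLowerSet A) (e : E) : prob p A ≤ prob (Function.update p e 0) A := by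
  have hmono : Monotone (Aᶜ.indicator (1 : Config E → R)) :=
    monotone_indicator_of_isUpperSet hA.compl
  have h01 := expect_update_zero_le_expect_update_one hp hmono e
  rw [← prob_eq_expect_indicator, ← prob_eq_expect_indicator, prob_compl, prob_compl] at h01
  have hpin := prob_eq_pin p A e
  have hq0 := hp.nonneg e
  have hq1 := hp.le_one e
  nlinarith [hpin, h01, hq0, hq1]

omit [Fintype E] [DecidableEq E] [LinearOrder R] [IsStrictOrderedRing R] in
/-- `Q = {a₁ ↮ a₂}` is decreasing. -/
lemma isLowerSet_avoidAll (a₁ a₂ : V) : IsLowerSet (avoidAll ends a₂ {a₁}) := by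
  intro ω ω' hle hω x hx hc
  exact hω x hx (conn_mono hle hc)

omit [Fintype E] [DecidableEq E] [LinearOrder R] [IsStrictOrderedRing R] in
/-- `PD = {a₁ ↮ a₂, a₃ ∉ U}` is decreasing. -/
lemma isLowerSet_PDEvent (a₁ a₂ a₃ : V) : IsLowerSet (PDEvent ends a₁ a₂ a₃) := by
  intro ω ω' hle hω
  refine ⟨fun hc => hω.1 (conn_mono hle hc), fun hc => hω.2 ?_⟩
  rcases hc with hc | hc
  · exact Or.inl (conn_mono hle hc)
  · exact Or.inr (conn_mono hle hc)

end Monotone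

/-! ## The induction -/

section Induction

variable (ends : E → Sym2 V)

/-- The edges of positive weight. -/
noncomputable def supp (p : E → R) : Finset E := Finset.univ.filter fun e => p e ≠ 0

omit [IsStrictOrderedRing R] in
/-- Deleting an edge removes it from the support. -/
lemma supp_update_zero (p : E → R) {e : E} (he : e ∈ supp p) :
    supp (Function.update p e 0) = (supp p).erase e := by
  ext e'
  by_cases h : e' = e
  · subst h; simp [supp]
  · simp [supp, h]

omit [DecidableEq E] [IsStrictOrderedRing R] in
/-- With no edge of positive weight there is no fractional edge. -/
lemma frac_eq_empty_of_supp_eq_empty (p : E → R) (h : supp p = ∅) : Chord.frac p = ∅ := by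
  ext e
  simp only [Chord.mem_frac, Finset.notMem_empty, iff_false, not_and, not_not]
  intro h0
  exfalso
  have : e ∈ supp p := by simp [supp, h0]
  rw [h] at this
  exact Finset.notMem_empty e this

/-- `D · P(Q) = 0` forces `Gc = 0` (the degenerate instances). -/
lemma Gc_eq_zero_of_degenerate' {p : E → R} (hp : IsProbVec p) (o a₁ a₂ a₃ b : V)
    (h : prob p (PDEvent ends a₁ a₂ a₃) * prob p (avoidAll ends a₂ {a₁}) = 0) :
    Gc p ends o a₁ a₂ a₃ b = 0 := by
  have hD : prob p (PDEvent ends a₁ a₂ a₃) = 0 := by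
    rcases mul_eq_zero.1 h with h | hQ
    · exact h
    · refine le_antisymm (hQ ▸ prob_mono hp fun ω hω => ?_) (prob_nonneg hp _)
      intro x hx hc
      rw [Finset.mem_singleton] at hx
      subst hx
      exact hω.1 (conn_symm hc)
  have hDo : Do p ends o a₁ a₂ a₃ = 0 := by
    unfold Do
    have h1 := prob_inter_le_left hp (PDEvent ends a₁ a₂ a₃) (connEvent ends a₁ o)
    have h2 := prob_inter_le_left hp (PDEvent ends a₁ a₂ a₃) (connEvent ends a₂ o)
    have h3 := prob_nonneg hp (PDEvent ends a₁ a₂ a₃ ∩ connEvent ends a₁ o)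
    have h4 := prob_nonneg hp (PDEvent ends a₁ a₂ a₃ ∩ connEvent ends a₂ o)
    linarith
  unfold Gc DEF
  rw [hD, hDo]
  ring

/-- **2′EDM/D ⟹ (HCOV)** (induction on the number of edges of positive weight). -/
theorem HCov_of_edmD (o a₁ a₂ a₃ b : V)
    (hrow : ∀ (q : E → R) (e : E), IsProbVec q → EdmD q ends e o a₁ a₂ a₃ b) :
    ∀ (n : ℕ) (p : E → R), IsProbVec p → (supp p).card = n → HCov p ends o a₁ a₂ a₃ b := by
  intro n
  induction n using Nat.strong_induction_on with
  | _ n ih =>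
  intro p hp hn
  unfold HCov
  by_cases hs : supp p = ∅
  · -- no fractional edge at all: `Gc = 0`
    have hroot : Chord.rootEdges p ends a₁ a₂ = ∅ := by
      unfold Chord.rootEdges
      rw [frac_eq_empty_of_supp_eq_empty p hs, Finset.filter_empty]
    rw [Chord.Gc_eq_zero_of_rootEdges_empty hroot]
  · obtain ⟨e, he⟩ := Finset.nonempty_iff_ne_empty.2 hs
    have hp₀ : IsProbVec (Function.update p e 0) := hp.update e le_rfl zero_le_one
    have hlt : ((supp p).erase e).card < n := by
      rw [← hn]
      exact Finset.card_erase_lt_of_mem he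
    have hIH : 0 ≤ Gc (Function.update p e 0) ends o a₁ a₂ a₃ b :=
      ih _ hlt _ hp₀ (congrArg Finset.card (supp_update_zero p he))
    have hedm := hrow p e hp
    unfold EdmD at hedm
    by_cases hdeg : prob p (PDEvent ends a₁ a₂ a₃) * prob p (avoidAll ends a₂ {a₁}) = 0
    · rw [Gc_eq_zero_of_degenerate' ends hp o a₁ a₂ a₃ b hdeg]
    · have hD : 0 ≤ prob p (PDEvent ends a₁ a₂ a₃) := prob_nonneg hp _
      have hQ : 0 ≤ prob p (avoidAll ends a₂ {a₁}) := prob_nonneg hp _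
      have hpos : 0 < prob p (PDEvent ends a₁ a₂ a₃) * prob p (avoidAll ends a₂ {a₁}) :=
        lt_of_le_of_ne (mul_nonneg hD hQ) (Ne.symm hdeg)
      have hDpos : 0 < prob p (PDEvent ends a₁ a₂ a₃) := by
        rcases hD.lt_or_eq with h | h
        · exact h
        · exact absurd (by rw [← h, zero_mul]) hdeg
      have hQpos : 0 < prob p (avoidAll ends a₂ {a₁}) := by
        rcases hQ.lt_or_eq with h | h
        · exact h
        · exact absurd (by rw [← h, mul_zero]) hdeg
      -- the deleted instance has larger `D` and `P(Q)`
      have hD₀ := prob_le_prob_update_zero_of_isLowerSet hp (isLowerSet_PDEvent ends a₁ a₂ a₃) e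
      have hQ₀ := prob_le_prob_update_zero_of_isLowerSet hp (isLowerSet_avoidAll ends a₁ a₂) e
      have hD₀pos : 0 < prob (Function.update p e 0) (PDEvent ends a₁ a₂ a₃) := hDpos.trans_le hD₀
      have hQ₀pos : 0 < prob (Function.update p e 0) (avoidAll ends a₂ {a₁}) := hQpos.trans_le hQ₀
      have hlhs : 0 ≤ (1 - p e) * Gc (Function.update p e 0) ends o a₁ a₂ a₃ b *
          prob p (PDEvent ends a₁ a₂ a₃) ^ 2 * prob p (avoidAll ends a₂ {a₁}) :=
        mul_nonneg (mul_nonneg (mul_nonneg (sub_nonneg.2 (hp.le_one e)) hIH) (sq_nonneg _)) hQ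
      have hden : 0 < prob (Function.update p e 0) (PDEvent ends a₁ a₂ a₃) ^ 2 *
          prob (Function.update p e 0) (avoidAll ends a₂ {a₁}) :=
        mul_pos (pow_pos hD₀pos 2) hQ₀pos
      have : 0 ≤ Gc p ends o a₁ a₂ a₃ b * (prob (Function.update p e 0) (PDEvent ends a₁ a₂ a₃) ^ 2 *
          prob (Function.update p e 0) (avoidAll ends a₂ {a₁})) := by
        rw [← mul_assoc]
        exact hlhs.trans hedm
      exact (mul_nonneg_iff_of_pos_right hden).1 this

end Induction

section ChainAll

variable (R : Type*) [Field R] [LinearOrder R] [IsStrictOrderedRing R]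

/-- **Row 2′EDM/D ⟹ row 2′HCOV** (all instances), hence the crux (ZΔ) by `ZDelta_all_of_HCov_all`. -/
theorem HCov_all_of_edmD_all (h : EdmD_all R) : HCov_all R := by
  intro V E _ _ _ _ ends p hp o a₁ a₂ a₃ b h12 h13 h23 ho1 ho2 ho3 hob hb1 hb2 hb3
  exact HCov_of_edmD ends o a₁ a₂ a₃ b
    (fun q e hq => h V E ends q hq e o a₁ a₂ a₃ b h12 h13 h23 ho1 ho2 ho3 hob hb1 hb2 hb3) _ p hp rfl

end ChainAll

end EdmRow

end Summit.Ventures.PercRepro2
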